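import Summits.BirchSwinnertonDyer.BirchSwinnertonDyer.Theorems.AlignedTransportAtTwoMainConjectureOfRankZeroBSDAtTwoHalfDescentBaseIndexLocal
import Summits.BirchSwinnertonDyer.Rank1Residual.Iwasawa.SelmerCardOfLevelZeroControlTamagawa
import Summits.BirchSwinnertonDyer.BirchSwinnertonDyer.Theorems.ByReductionTypeAtTwoEulerCharFormalBound
import HarnessLib

/-!
# Route `AlignedTransportAtTwo`, crux C2 `MainConjectureOfRankZeroBSDAtTwo` (stmt-BirchSwinnertonDyer-22298):
# THE BASE TERM CARRIES `p^μ`, X — THE TAMAGAWA TERM: for EVERY elliptic curve over EVERY number field, every `p`, every `ℤ_p`-extension and every finite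
# `S ⊇ {v ∣ p} ∪ {bad v}`: `#ker g_0 ≤ ∏_{v∈S, v∣p} #𝒦_{v,0}[p^∞] · ∏_{v∈S, v∤p} p^{ord_p c_v(E/K)}`, hence
# `μ(X(E/K_∞)) ≤ log_p(#Sel_{p^∞}(E/K)·∏_{v∈S, v∣p} #𝒦_{v,0}[p^∞] · p^{Σ_{v∈S, v∤p} ord_p c_v})`; with the sockets above `p` shut, `#ker g_0 ≤ p^{ord_p Tam(E/K)}`

HONEST FRAMING (cell `bsd-f1-sign2`, WIDTH-5 attached prover seat `bsd-line-att-p5` gen 61 on line `birth` of the lead `bsd-line-att-p2`;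
`--supports` stmt-BirchSwinnertonDyer-22298, closes nothing; BSD is NOT proved by any of this; the crux C2, its verdict «blocked-on
`Rank1Residual.GreenbergMuConjectureIrreducible`» and every registered stub (P / T / Kμ / LimDoor / MuIneqʳ / PFμ⁺) are untouched). THEOREMS ONLY — no `def`,
no instance, no named fact, no `sorry`. Route-independent. This is gen 60's successor (iii) «the local kernels in NUMBERS»: sequel of `…BaseIndexLocal`
(`#ker g_0 ≤ ∏_{v∈S} #𝒦_{v,0}[p^∞]`, `μ ≤ log_p(#Sel·∏#𝒦)`) and `…BaseIndexLocalExplicit` (away from `p`: `≤ max 4 (p^{v_p ord_v Δ})`), with the tree's SHARP form of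
Greenberg's Lemma 3.3 at the base for an arbitrary number field (`Rank1Residual.Iwasawa.natCard_localTowerKerPrimary_zero_le_pow_padicValNat_localTamagawaNumber`,
cell b2b-bsdres: `#𝒦_{v,0}[p^∞] ≤ p^{ord_p c_v}` at every `v ∤ p`, ANY `ℤ_p`-extension, ANY reduction type; `c_v` the Tamagawa number of `E` over `K_v`). So away from `p`
every local factor is now the `p`-part of a TAMAGAWA NUMBER (`= 1` wherever `p ∤ c_v`), and with the at-`p` sockets shut the whole control kernel at the base is bounded by
`p^{ord_p Tam(E/K)}` (b2b's `sum_padicValNat_localTamagawaNumber_eq`). NOT redone here: the Tamagawa base door «`#Sel_{p^∞}(E/K) = 1`, `p ∤ c_v` (`v ∤ p`), sockets shut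
above `p` ⟹ `X(E/K_∞) = 0`», which is the tree's `Rank1Residual.Iwasawa.subsingleton_X_of_card_selmer_eq_one_of_not_dvd_localTamagawaNumber` (Greenberg's Prop. 3.8).

* §1 ★★ `natCard_kerG_zero_le_prod_tamagawa`: **`#ker g_0 ≤ ∏_{v∈S} b_v`**, `b_v = #𝒦_{v,0}[p^∞]` if `v ∣ p`, `b_v = p^{ord_p c_v}` if `v ∤ p` (`S ⊇ {v∣p} ∪ bad`, `𝒦_{v,0}[p^∞]` finite at `v ∣ p`);
  ★★ `natCard_kerG_zero_le_pow_padicValNat_tamagawaProduct`: sockets shut above `p` ⟹ **`#ker g_0 ≤ p^{ord_p Tam(E/K)}`**.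
* §2 ★★ `mu_le_log_tamagawa`: **`p^{μ} ≤ #Sel_{p^∞}(E/K)·∏_{v∈S} b_v`**, **`μ ≤ log_p(#Sel_{p^∞}(E/K)·∏_{v∈S} b_v)`**; ★★ `mu_le_log_selmer_add_padicValNat_tamagawaProduct`: sockets shut above `p` ⟹
  **`μ(X(E/K_∞)) ≤ log_p #Sel_{p^∞}(E/K) + ord_p Tam(E/K)`** — for EVERY `K`, `p`, `κ` (no Euler-characteristic theorem, no duality, no `E(K)[p] = 0`).
* §3 (`K = ℚ`, good ORDINARY `p`, ANY prime, `κ` cyclotomic; the at-`p` socket discharged by the tree's UPPER half of Greenberg's Lemma 3.4 at layer `0`, cell bsd-2adic K4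
  `GoodOrdTower.natCard_localTowerKerPrimary_zero_le`: `#𝒦_{p,0}[p^∞] ≤ #W̃(𝔽_p)·p^{ord_p #W̃(𝔽_p)}`, kernel) ★★★ `natCard_kerG_zero_le_prod_explicit_rat`, ★★★ `natCard_kerG_zero_le_explicit_rat`:
  **`#ker g_0(W) ≤ #W̃(𝔽_p)·p^{ord_p #W̃(𝔽_p)}·p^{ord_p Tam(W)}`** — Greenberg's control kernel at the base bounded by classical invariants of `W`, print-free; ★★★ `mu_le_log_explicit_rat`:
  **`μ(X(W/ℚ_∞)) ≤ log_p(#Sel_{p^∞}(W/ℚ)·#W̃(𝔽_p)·p^{ord_p #W̃(𝔽_p)}) + ord_p Tam(W)`** (gen 60's `…BaseIndexLocalExplicit.mu_le_log_explicit_rat` with BOTH remaining sockets evaluated).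
* §4 (`p = 2`, the seed cell of C2: `#W̃(𝔽₂) ∈ {2, 4}` a power of `2`) ★★ `natCard_kerG_zero_le_two_pow`: **`#ker g_0(W) ≤ 2^{2·ord₂ #W̃(𝔽₂) + ord₂ Tam(W)}`**; ★★ `mu_le_log_add_two`:
  **`2^{μ₂} ∣ #Sel_{2^∞}(W/ℚ)·#ker g_0`, `μ₂(X(W/ℚ_∞)) ≤ log₂ #Sel_{2^∞}(W/ℚ) + 2·ord₂ #W̃(𝔽₂) + ord₂ Tam(W)`** — the seed's only non-print input bounded by honest descent data, locally.
HONESTY: over `ℚ` the Euler-characteristic value (kernel Thm. 4.1, sibling file `…BaseIndexEuler`) is sharper by the torsion term `2·ord_p #W(ℚ)[p^∞]` and exact; the merit of §3–§4 is the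
bound on `#ker g_0` ITSELF and the absence of any duality input; §1–§2 hold over every number field, where no Euler-characteristic theorem is in the tree. On the seed cell `2` is
anomalous, so no bound here certifies `μ₂ = 0` by itself. Nothing numerical is asserted; C2 untouched. Memo `Cruxes/MainConjectureOfRankZeroBSDAtTwo/EULER-BRIDGE-att-p5-g61.md`.

References: R. Greenberg, LNM 1716 (1999), §3 Lemmas 3.3–3.5 (pp. 86–90), Prop. 3.8 (p. 95), §4 Thm. 4.1, Lemma 4.4 [GreenbergLNM1716]; J. Silverman, AEC, V §1, VII.6.1 [SilvermanAEC2009];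
J. Milne, ADT, I Thm. 2.8 [MilneADT2006].
-/

set_option linter.dupNamespace false
set_option autoImplicit false

noncomputable section

open scoped Classical Polynomial

universe u

namespace Summit.BirchSwinnertonDyer.BirchSwinnertonDyer.Theorems.AlignedTransportAtTwoHalfDescentBaseIndexTamagawa

open NumberField IsDedekindDomain WeierstrassCurve Literature.NumberTheory.EllipticCurves Literature.NumberTheory.GaloisRepresentations
  Literature.NumberTheory.EllipticCurves.IwasawaAlgebra
  Summit.BirchSwinnertonDyer.Rank1Residual.X1.MuLambda
  Summit.BirchSwinnertonDyer.Rank1Residual.Iwasawa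
  Summit.BirchSwinnertonDyer.BirchSwinnertonDyer.Theorems.AlignedTransportAtTwoHalfDescentBaseIndexSelmer
  Summit.BirchSwinnertonDyer.BirchSwinnertonDyer.Theorems.AlignedTransportAtTwoHalfDescentBaseIndexLocal

variable {p : ℕ} [hp : Fact p.Prime]

/-- `Nat.log p (a · p^k) = Nat.log p a + k` for `a ≠ 0`. [folklore] -/
private theorem log_mul_pow_eq (a k : ℕ) (ha : a ≠ 0) : Nat.log p (a * p ^ k) = Nat.log p a + k := by
  induction k with
  | zero => simp
  | succ k ih =>
    rw [pow_succ, ← mul_assoc, Nat.log_mul_base hp.out.one_lt (mul_ne_zero ha (pow_ne_zero _ hp.out.ne_zero)), ih, Nat.add_assoc]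

section AnyField

variable {K : Type u} [Field K] [NumberField K] (W : WeierstrassCurve K) [W.IsElliptic] (κ : ZpExtension K p) {γ : Field.absoluteGaloisGroup K}

/-! ## §1 The control kernel at the base against the Tamagawa numbers -/

section KerG

/-- ★★ **`#ker g_0 ≤ ∏_{v∈S} b_v` with `b_v = #𝒦_{v,0}[p^∞]` at `v ∣ p` and `b_v = p^{ord_p c_v(E/K)}` at `v ∤ p`** — `E/K` elliptic over ANY number field, ANY `p`, ANY
`ℤ_p`-extension `κ`, any finite `S` containing every place above `p` or of bad reduction, `𝒦_{v,0}[p^∞]` finite at the places of `S` above `p`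
(`c_v` = the Tamagawa number of `E` over the completion `K_v`). Gen 60's `#ker g_0 ≤ ∏_{v∈S} #𝒦_{v,0}[p^∞]` with each factor away from `p` bounded by the tree's SHARP
Lemma 3.3 `#𝒦_{v,0}[p^∞] ≤ p^{ord_p c_v}`. [cite: GreenbergLNM1716, §3 Lemmas 3.3–3.5 (pp. 86–90) and §4 proof of Thm. 4.1] -/
theorem natCard_kerG_zero_le_prod_tamagawa (S : Finset (HeightOneSpectrum (𝓞 K)))
    (hS : ∀ v : HeightOneSpectrum (𝓞 K), (p : 𝓞 K) ∈ v.asIdeal ∨ ¬ W.HasGoodReductionAt v → v ∈ S)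
    (hfinP : ∀ v ∈ S, (p : 𝓞 K) ∈ v.asIdeal → Finite (W.localTowerKerPrimary κ (v.adicCompletion K) 0)) :
    Finite (W.KerG κ 0) ∧ Nat.card (W.KerG κ 0) ≤
      ∏ v ∈ S, (if (p : 𝓞 K) ∈ v.asIdeal then Nat.card (W.localTowerKerPrimary κ (v.adicCompletion K) 0)
        else p ^ padicValNat p ((W.baseChange (v.adicCompletion K)).localTamagawaNumber (v.adicCompletionIntegers K))) := by
  obtain ⟨hfin, hle⟩ := finite_kerG_zero_and_card_le_prod_of_finite_atP W κ S hS hfinP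
  refine ⟨hfin, hle.trans (Finset.prod_le_prod (fun v _ ↦ Nat.zero_le _) fun v _ ↦ ?_)⟩
  split_ifs with hpv
  · exact le_rfl
  · exact natCard_localTowerKerPrimary_zero_le_pow_padicValNat_localTamagawaNumber W κ hpv

/-- ★★ **Sockets shut above `p` ⟹ `#ker g_0 ≤ ∏_{v∈S} #𝒦_{v,0}[p^∞] ≤ p^{Σ_{v∈S} ord_p c_v} = p^{ord_p Tam(E/K)}`.** `E/K` elliptic, any `p`, any `ℤ_p`-extension; `S` any finite set
of places containing every place above `p` or of bad reduction, with `𝒦_{v,0}[p^∞] = 0` at the places of `S` above `p` (good ordinary non-anomalous, additive potentially good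
ordinary, multiplicative sockets of the tree). [cite: GreenbergLNM1716, §3 Lemmas 3.3–3.5, Prop. 3.8 Remark (p. 95)] -/
theorem natCard_kerG_zero_le_pow_padicValNat_tamagawaProduct (S : Finset (HeightOneSpectrum (𝓞 K)))
    (hS : ∀ v : HeightOneSpectrum (𝓞 K), (p : 𝓞 K) ∈ v.asIdeal ∨ ¬ W.HasGoodReductionAt v → v ∈ S)
    (hSp : ∀ v ∈ S, (p : 𝓞 K) ∈ v.asIdeal → W.localTowerKerPrimary κ (v.adicCompletion K) 0 = ⊥) :
    Finite (W.KerG κ 0) ∧ Nat.card (W.KerG κ 0) ≤ p ^ padicValNat p W.tamagawaProduct := by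
  have hfinP : ∀ v ∈ S, (p : 𝓞 K) ∈ v.asIdeal → Finite (W.localTowerKerPrimary κ (v.adicCompletion K) 0) := fun v hv hpv ↦ by
    rw [hSp v hv hpv]; infer_instance
  obtain ⟨hfin, hle⟩ := finite_kerG_zero_and_card_le_prod_of_finite_atP W κ S hS hfinP
  obtain ⟨hfinS, hdvd⟩ := prod_natCard_localTowerKerPrimary_dvd_pow_sum W κ S hSp
  have hgood : ∀ v ∉ S, W.HasGoodReductionAt v := fun v hv ↦ by
    by_contra h; exact hv (hS v (Or.inr h))
  rw [sum_padicValNat_localTamagawaNumber_eq W S hgood] at hdvd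
  exact ⟨hfin, hle.trans (Nat.le_of_dvd (pow_pos hp.out.pos _) hdvd)⟩

end KerG

/-! ## §2 `μ` against the base Selmer group, the at-`p` kernels and the Tamagawa numbers -/

section Mu

/-- ★★ **`p^{μ(X(E/K_∞))} ≤ #Sel_{p^∞}(E/K)·∏_{v∈S} b_v` and `μ ≤ log_p(#Sel_{p^∞}(E/K)·∏_{v∈S} b_v)`** (`b_v = #𝒦_{v,0}[p^∞]` at `v ∣ p`, `p^{ord_p c_v}` at `v ∤ p`) whenever `Sel_{p^∞}(E/K)` is
finite — `E/K` elliptic, any `p`, any `ℤ_p`-extension with topological generator `γ`, any Pontryagin-dual datum with `X` f.g. torsion, `S ⊇ {v∣p} ∪ bad`, `𝒦_{v,0}[p^∞]` finite above `p`.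
[cite: GreenbergLNM1716, Conj. 1.11, §3 Lemmas 3.3–3.5, §4 Thm. 4.1, Lemmas 4.3–4.4] -/
theorem mu_le_log_tamagawa (hγ : κ.IsTopGenerator γ) (D : W.SelmerDualData κ γ) [Module.Finite (IwasawaAlgebra p) D.X] (hD : D.IsTorsion)
    (S : Finset (HeightOneSpectrum (𝓞 K))) (hS : ∀ v : HeightOneSpectrum (𝓞 K), (p : 𝓞 K) ∈ v.asIdeal ∨ ¬ W.HasGoodReductionAt v → v ∈ S)
    (hfinP : ∀ v ∈ S, (p : 𝓞 K) ∈ v.asIdeal → Finite (W.localTowerKerPrimary κ (v.adicCompletion K) 0)) [Finite ↥(W.selmerLayer κ 0)] :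
    p ^ D.mu ≤ Nat.card ↥(W.selmerLayer κ 0) *
        ∏ v ∈ S, (if (p : 𝓞 K) ∈ v.asIdeal then Nat.card (W.localTowerKerPrimary κ (v.adicCompletion K) 0)
          else p ^ padicValNat p ((W.baseChange (v.adicCompletion K)).localTamagawaNumber (v.adicCompletionIntegers K))) ∧
      D.mu ≤ Nat.log p (Nat.card ↥(W.selmerLayer κ 0) *
        ∏ v ∈ S, (if (p : 𝓞 K) ∈ v.asIdeal then Nat.card (W.localTowerKerPrimary κ (v.adicCompletion K) 0)
          else p ^ padicValNat p ((W.baseChange (v.adicCompletion K)).localTamagawaNumber (v.adicCompletionIntegers K)))) := by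
  obtain ⟨hfin, hle⟩ := natCard_kerG_zero_le_prod_tamagawa W κ S hS hfinP
  haveI := hfin
  have hdvd := pow_mu_dvd_natCard_selmerLayer_zero_mul_kerG_zero W κ hγ D hD
  have h1 := (Nat.le_of_dvd (Nat.mul_pos Nat.card_pos Nat.card_pos) hdvd).trans (Nat.mul_le_mul_left _ hle)
  exact ⟨h1, Nat.le_log_of_pow_le hp.out.one_lt h1⟩

/-- ★★ **Sockets shut above `p` ⟹ `p^{μ} ≤ #Sel_{p^∞}(E/K)·p^{ord_p Tam(E/K)}` and `μ(X(E/K_∞)) ≤ log_p #Sel_{p^∞}(E/K) + ord_p Tam(E/K)`** — `E/K` elliptic over ANY number field,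
ANY `p`, ANY `ℤ_p`-extension with topological generator `γ`, any dual datum with `X` f.g. torsion, `Sel_{p^∞}(E/K)` finite, `S ⊇ {v∣p} ∪ bad` with `𝒦_{v,0}[p^∞] = 0` at its places above
`p`. The `μ`-invariant is bounded by the base Selmer group and the Tamagawa product alone — Greenberg's «`μ ≤ ord_p f_E(0)` and `f_E(0) ∣ #Sel·∏c_v^{(p)}`» for every `K`, `p`, `κ`,
with no Euler-characteristic theorem, no duality and no hypothesis on `E(K)[p]`. [cite: GreenbergLNM1716, Conj. 1.11, §3 Prop. 3.8, §4 Thm. 4.1 and Lemma 4.4] -/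
theorem mu_le_log_selmer_add_padicValNat_tamagawaProduct (hγ : κ.IsTopGenerator γ) (D : W.SelmerDualData κ γ) [Module.Finite (IwasawaAlgebra p) D.X]
    (hD : D.IsTorsion) (S : Finset (HeightOneSpectrum (𝓞 K))) (hS : ∀ v : HeightOneSpectrum (𝓞 K), (p : 𝓞 K) ∈ v.asIdeal ∨ ¬ W.HasGoodReductionAt v → v ∈ S)
    (hSp : ∀ v ∈ S, (p : 𝓞 K) ∈ v.asIdeal → W.localTowerKerPrimary κ (v.adicCompletion K) 0 = ⊥) [Finite ↥(W.selmerLayer κ 0)] :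
    p ^ D.mu ≤ Nat.card ↥(W.selmerLayer κ 0) * p ^ padicValNat p W.tamagawaProduct ∧
      D.mu ≤ Nat.log p (Nat.card ↥(W.selmerLayer κ 0)) + padicValNat p W.tamagawaProduct := by
  obtain ⟨hfin, hle⟩ := natCard_kerG_zero_le_pow_padicValNat_tamagawaProduct W κ S hS hSp
  haveI := hfin
  have hdvd := pow_mu_dvd_natCard_selmerLayer_zero_mul_kerG_zero W κ hγ D hD
  have h1 := (Nat.le_of_dvd (Nat.mul_pos Nat.card_pos Nat.card_pos) hdvd).trans (Nat.mul_le_mul_left _ hle)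
  refine ⟨h1, ?_⟩
  have h2 := Nat.le_log_of_pow_le hp.out.one_lt h1
  rwa [log_mul_pow_eq _ _ Nat.card_pos.ne'] at h2

/-- ★★ **The same with the base Selmer group read as `Sel_{p^∞}(E/K)` (`W.selmerGroupPInfty p`)**: sockets shut above `p` and `Sel_{p^∞}(E/K)` finite ⟹
**`μ(X(E/K_∞)) ≤ log_p #Sel_{p^∞}(E/K) + ord_p Tam(E/K)`** (tree `natCard_selmerLayer_zero_eq`, `finite_selmerLayer_zero`). [cite: GreenbergLNM1716, Conj. 1.11, §3 Prop. 3.8, §4 Thm. 4.1] -/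
theorem mu_le_log_selmerGroupPInfty_add_padicValNat_tamagawaProduct (hγ : κ.IsTopGenerator γ) (D : W.SelmerDualData κ γ) [Module.Finite (IwasawaAlgebra p) D.X]
    (hD : D.IsTorsion) (S : Finset (HeightOneSpectrum (𝓞 K))) (hS : ∀ v : HeightOneSpectrum (𝓞 K), (p : 𝓞 K) ∈ v.asIdeal ∨ ¬ W.HasGoodReductionAt v → v ∈ S)
    (hSp : ∀ v ∈ S, (p : 𝓞 K) ∈ v.asIdeal → W.localTowerKerPrimary κ (v.adicCompletion K) 0 = ⊥) [hSel : Finite ↥(W.selmerGroupPInfty p)] :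
    D.mu ≤ Nat.log p (Nat.card ↥(W.selmerGroupPInfty p)) + padicValNat p W.tamagawaProduct := by
  haveI : Finite ↥(W.selmerLayer κ 0) := W.finite_selmerLayer_zero κ hSel
  have h := (mu_le_log_selmer_add_padicValNat_tamagawaProduct W κ hγ D hD S hS hSp).2
  rwa [W.natCard_selmerLayer_zero_eq κ] at h

end Mu

end AnyField

/-! ## §3 `K = ℚ`, good ordinary `p` (any prime): every socket discharged in the kernel -/

section Rat

variable (W : WeierstrassCurve ℚ) [W.IsElliptic] [W.IsGloballyMinimal] (κ : ZpExtension ℚ p) {γ : Field.absoluteGaloisGroup ℚ}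

/-- Two finite places of `ℚ` containing the same rational prime coincide (`primesEquiv`). [folklore] -/
private theorem eq_of_natCast_mem {v v' : HeightOneSpectrum (𝓞 ℚ)} (hv : (p : 𝓞 ℚ) ∈ v.asIdeal) (hv' : (p : 𝓞 ℚ) ∈ v'.asIdeal) : v = v' :=
  (Rat.HeightOneSpectrum.primesEquiv (R := 𝓞 ℚ)).injective
    (Subtype.ext ((Rat.HeightOneSpectrum.primesEquiv_eq_of_natCast_mem v hp.out hv).trans
      (Rat.HeightOneSpectrum.primesEquiv_eq_of_natCast_mem v' hp.out hv').symm))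

/-- A product of `if`-split factors over the finite places: if at most the places containing `p` take the value `A ≥ 1` and the others take values `B v ≥ 1`, then the product is
at most `A · ∏_{v∈S} B v` (over `ℚ` at most one place contains `p`). [folklore] -/
private theorem prod_ite_le_mul_prod (S : Finset (HeightOneSpectrum (𝓞 ℚ))) (A : ℕ) (B : HeightOneSpectrum (𝓞 ℚ) → ℕ) (hA : 1 ≤ A) (hB : ∀ v ∈ S, 1 ≤ B v) :
    ∏ v ∈ S, (if (p : 𝓞 ℚ) ∈ v.asIdeal then A else B v) ≤ A * ∏ v ∈ S, B v := by
  by_cases h : ∃ v₀ ∈ S, (p : 𝓞 ℚ) ∈ v₀.asIdeal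
  · obtain ⟨v₀, hv₀S, hv₀⟩ := h
    rw [← Finset.mul_prod_erase S _ hv₀S, if_pos hv₀]
    refine Nat.mul_le_mul_left _ ?_
    calc ∏ v ∈ S.erase v₀, (if (p : 𝓞 ℚ) ∈ v.asIdeal then A else B v) = ∏ v ∈ S.erase v₀, B v :=
          Finset.prod_congr rfl fun v hv ↦ by
            rw [if_neg]
            intro hpv
            exact (Finset.mem_erase.mp hv).1 (eq_of_natCast_mem hpv hv₀)
      _ ≤ ∏ v ∈ S, B v := Finset.prod_le_prod_of_subset_of_one_le' (Finset.erase_subset v₀ S) fun v hv _ ↦ hB v hv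
  · push Not at h
    calc ∏ v ∈ S, (if (p : 𝓞 ℚ) ∈ v.asIdeal then A else B v) = ∏ v ∈ S, B v :=
          Finset.prod_congr rfl fun v hv ↦ by rw [if_neg (h v hv)]
      _ ≤ A * ∏ v ∈ S, B v := Nat.le_mul_of_pos_left _ hA

/-- ★★★ **Over `ℚ` at a good ORDINARY prime `p` (ANY `p`), `κ` cyclotomic, `W` globally minimal, any finite `S ⊇ {p} ∪ {bad}`:
`#ker g_0 ≤ ∏_{v∈S} b_v` with `b_p = #W̃(𝔽_p)·p^{ord_p #W̃(𝔽_p)}` and `b_ℓ = p^{ord_p c_ℓ}` (`ℓ ≠ p`)** — EVERY local factor a classical invariant of `W`: the at-`p` socket is the tree's UPPER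
half of Greenberg's Lemma 3.4 at layer `0` (K4, `GoodOrdTower.natCard_localTowerKerPrimary_zero_le`, kernel), the others the tree's sharp Lemma 3.3. No print binder, no Euler-characteristic theorem.
[cite: GreenbergLNM1716, §3 Lemmas 3.3–3.5 (pp. 86–90)] -/
theorem natCard_kerG_zero_le_prod_explicit_rat (hgo : Rank1Residual.GoodOrd W p) (hκ : κ.IsCyclotomic) (S : Finset (HeightOneSpectrum (𝓞 ℚ)))
    (hS : ∀ v : HeightOneSpectrum (𝓞 ℚ), (p : 𝓞 ℚ) ∈ v.asIdeal ∨ ¬ W.HasGoodReductionAt v → v ∈ S) :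
    Finite (W.KerG κ 0) ∧ Nat.card (W.KerG κ 0) ≤
      ∏ v ∈ S, (if (p : 𝓞 ℚ) ∈ v.asIdeal then W.reductionPointCount p * p ^ padicValNat p (W.reductionPointCount p)
        else p ^ padicValNat p ((W.baseChange (v.adicCompletion ℚ)).localTamagawaNumber (v.adicCompletionIntegers ℚ))) := by
  have hord : W.HasGoodReductionAtPrime p ∧ ¬ (p : ℤ) ∣ W.frobeniusTrace p := hgo
  have hΔ : ¬ (p : ℤ) ∣ minimalDiscriminantInt W := W.not_dvd_minimalDiscriminantInt_of_hasGoodReductionAtPrime' p hord.1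
  have hfinP : ∀ v ∈ S, (p : 𝓞 ℚ) ∈ v.asIdeal → Finite (W.localTowerKerPrimary κ (v.adicCompletion ℚ) 0) :=
    fun v _ hpv ↦ W.finite_localTowerKerPrimary_zero_of_ordinary hpv hΔ hord.2 κ hκ
  obtain ⟨hfin, hle⟩ := natCard_kerG_zero_le_prod_tamagawa W κ S hS hfinP
  refine ⟨hfin, hle.trans (Finset.prod_le_prod (fun v _ ↦ Nat.zero_le _) fun v _ ↦ ?_)⟩
  split_ifs with hpv
  · exact GoodOrdTower.natCard_localTowerKerPrimary_zero_le hκ v hpv W hgo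
  · exact le_rfl

/-- ★★★ **`#ker g_0(W) ≤ #W̃(𝔽_p) · p^{ord_p #W̃(𝔽_p)} · p^{ord_p Tam(W)}`** for every `W/ℚ` (globally minimal) with good ORDINARY reduction at `p` (ANY prime `p`) and the cyclotomic
`ℤ_p`-extension: Greenberg's control kernel at the base bounded by the number of points mod `p` and the Tamagawa product — print-free, Thm-4.1-free, in the kernel.
(`S ⊇ {p} ∪ {bad}` is any witness set; over `ℚ` exactly one place lies above `p`.) [cite: GreenbergLNM1716, §3 Lemmas 3.3–3.5, §4 proof of Thm. 4.1] -/
theorem natCard_kerG_zero_le_explicit_rat (hgo : Rank1Residual.GoodOrd W p) (hκ : κ.IsCyclotomic) (S : Finset (HeightOneSpectrum (𝓞 ℚ)))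
    (hS : ∀ v : HeightOneSpectrum (𝓞 ℚ), (p : 𝓞 ℚ) ∈ v.asIdeal ∨ ¬ W.HasGoodReductionAt v → v ∈ S) :
    Finite (W.KerG κ 0) ∧
      Nat.card (W.KerG κ 0) ≤ W.reductionPointCount p * p ^ padicValNat p (W.reductionPointCount p) * p ^ padicValNat p W.tamagawaProduct := by
  obtain ⟨hfin, hle⟩ := natCard_kerG_zero_le_prod_explicit_rat W κ hgo hκ S hS
  have hgood : ∀ v ∉ S, W.HasGoodReductionAt v := fun v hv ↦ by
    by_contra h; exact hv (hS v (Or.inr h))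
  refine ⟨hfin, hle.trans ((prod_ite_le_mul_prod S _ _ (Nat.mul_pos (W.reductionPointCount_pos p) (pow_pos hp.out.pos _))
    (fun v _ ↦ pow_pos hp.out.pos _)).trans (le_of_eq ?_))⟩
  rw [Finset.prod_pow_eq_pow_sum, sum_padicValNat_localTamagawaNumber_eq W S hgood]

/-- ★★★ **`p^{μ} ∣ #Sel_{p^∞}(W/ℚ)·#ker g_0` and `μ(X(W/ℚ_∞)) ≤ log_p(#Sel_{p^∞}(W/ℚ) · #W̃(𝔽_p)·p^{ord_p #W̃(𝔽_p)}) + ord_p Tam(W)`** — `W/ℚ` globally minimal, good ORDINARY at `p` (ANY `p`), `κ` cyclotomic with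
topological generator `γ`, any torsion dual datum, `Sel_{p^∞}(W/ℚ)` finite. Greenberg's `μ ≤ ord_p f_E(0) = ord_p(#Sel·#W̃(𝔽_p)[p^∞]²·∏c_ℓ/#W(ℚ)[p^∞]²)` in its LOCAL form: every factor of gen 60's
locality bound is now evaluated (the at-`p` factor by its upper half `#W̃(𝔽_p)·p^{ord_p #W̃(𝔽_p)} ≥ #W̃(𝔽_p)[p^∞]²`); weaker than the Euler-characteristic value by the torsion term, but with no
duality input. [cite: GreenbergLNM1716, Conj. 1.11, §3 Lemmas 3.3–3.5, §4 Thm. 4.1, Lemma 4.4] -/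
theorem mu_le_log_explicit_rat (hgo : Rank1Residual.GoodOrd W p) (hκ : κ.IsCyclotomic) (hγ : κ.IsTopGenerator γ) (D : W.SelmerDualData κ γ) (hD : D.IsTorsion)
    (S : Finset (HeightOneSpectrum (𝓞 ℚ))) (hS : ∀ v : HeightOneSpectrum (𝓞 ℚ), (p : 𝓞 ℚ) ∈ v.asIdeal ∨ ¬ W.HasGoodReductionAt v → v ∈ S) [hSel : Finite ↥(W.selmerGroupPInfty p)] :
    p ^ D.mu ∣ Nat.card ↥(W.selmerGroupPInfty p) * Nat.card (W.KerG κ 0) ∧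
      D.mu ≤ Nat.log p (Nat.card ↥(W.selmerGroupPInfty p) * (W.reductionPointCount p * p ^ padicValNat p (W.reductionPointCount p))) + padicValNat p W.tamagawaProduct := by
  haveI : Module.Finite (IwasawaAlgebra p) D.X := D.module_finite_holds hγ
  haveI : Finite ↥(W.selmerLayer κ 0) := W.finite_selmerLayer_zero κ hSel
  obtain ⟨hfin, hle⟩ := natCard_kerG_zero_le_explicit_rat W κ hgo hκ S hS
  haveI := hfin
  have hdvd := pow_mu_dvd_natCard_selmerLayer_zero_mul_kerG_zero W κ hγ D hD
  rw [W.natCard_selmerLayer_zero_eq κ] at hdvd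
  refine ⟨hdvd, ?_⟩
  have h1 : p ^ D.mu ≤ Nat.card ↥(W.selmerGroupPInfty p) * (W.reductionPointCount p * p ^ padicValNat p (W.reductionPointCount p)) * p ^ padicValNat p W.tamagawaProduct := by
    rw [mul_assoc]
    exact (Nat.le_of_dvd (Nat.mul_pos Nat.card_pos Nat.card_pos) hdvd).trans (Nat.mul_le_mul_left _ hle)
  have h2 := Nat.le_log_of_pow_le hp.out.one_lt h1
  rwa [log_mul_pow_eq _ _ (Nat.mul_pos Nat.card_pos (Nat.mul_pos (W.reductionPointCount_pos p) (pow_pos hp.out.pos _))).ne'] at h2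

end Rat

/-! ## §4 `p = 2` (the seed cell of C2) -/

section Two

variable (W : WeierstrassCurve ℚ) [W.IsElliptic] [W.IsGloballyMinimal] (κ₂ : ZpExtension ℚ 2) {γ : Field.absoluteGaloisGroup ℚ}

/-- ★★ **At `p = 2`: `#ker g_0(W) ≤ #W̃(𝔽₂)² · 2^{ord₂ Tam(W)} = 2^{2·ord₂ #W̃(𝔽₂) + ord₂ Tam(W)}`** for every `W/ℚ` (globally minimal) with good ORDINARY reduction at `2` (`#W̃(𝔽₂) ∈ {2,4}` is a power of `2`,
tree `GoodOrdTower.reductionPointCount_two_eq_pow`) and the cyclotomic `ℤ₂`-extension. [cite: GreenbergLNM1716, §3 Lemmas 3.3–3.5] -/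
theorem natCard_kerG_zero_le_two_pow (hgo : Rank1Residual.GoodOrd W 2) (hκ : κ₂.IsCyclotomic) (S : Finset (HeightOneSpectrum (𝓞 ℚ)))
    (hS : ∀ v : HeightOneSpectrum (𝓞 ℚ), ((2 : ℕ) : 𝓞 ℚ) ∈ v.asIdeal ∨ ¬ W.HasGoodReductionAt v → v ∈ S) :
    Finite (W.KerG κ₂ 0) ∧ Nat.card (W.KerG κ₂ 0) ≤ 2 ^ (2 * padicValNat 2 (W.reductionPointCount 2) + padicValNat 2 W.tamagawaProduct) := by
  obtain ⟨hfin, hle⟩ := natCard_kerG_zero_le_explicit_rat W κ₂ hgo hκ S hS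
  refine ⟨hfin, hle.trans (le_of_eq ?_)⟩
  nth_rw 1 [GoodOrdTower.reductionPointCount_two_eq_pow W hgo]
  rw [← pow_add, ← pow_add]
  congr 1
  ring

/-- ★★ **At `p = 2`: `2^{μ₂} ∣ #Sel_{2^∞}(W/ℚ)·#ker g_0` and `μ₂(X(W/ℚ_∞)) ≤ log₂ #Sel_{2^∞}(W/ℚ) + 2·ord₂ #W̃(𝔽₂) + ord₂ Tam(W)`** — `W/ℚ` globally minimal, good ORDINARY at `2`, `κ` cyclotomic with generator `γ`, any
torsion dual datum, `Sel_{2^∞}(W/ℚ)` finite. The seed cell's only non-print input for C2 is `μ₂ = 0`; this is its unconditional LOCAL upper bound in classical invariants (no Euler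
characteristic, no duality). On the seed cell `2` is anomalous (`ord₂ #W̃(𝔽₂) ≥ 1`), so the bound is `≥ 2` and never certifies `μ₂ = 0` by itself — the content is the bound. [cite: GreenbergLNM1716, Conj. 1.11, §3, §4 Thm. 4.1] -/
theorem mu_le_log_add_two (hgo : Rank1Residual.GoodOrd W 2) (hκ : κ₂.IsCyclotomic) (hγ : κ₂.IsTopGenerator γ) (D : W.SelmerDualData κ₂ γ) (hD : D.IsTorsion)
    (S : Finset (HeightOneSpectrum (𝓞 ℚ))) (hS : ∀ v : HeightOneSpectrum (𝓞 ℚ), ((2 : ℕ) : 𝓞 ℚ) ∈ v.asIdeal ∨ ¬ W.HasGoodReductionAt v → v ∈ S) [hSel : Finite ↥(W.selmerGroupPInfty 2)] :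
    2 ^ D.mu ∣ Nat.card ↥(W.selmerGroupPInfty 2) * Nat.card (W.KerG κ₂ 0) ∧
      D.mu ≤ Nat.log 2 (Nat.card ↥(W.selmerGroupPInfty 2)) + (2 * padicValNat 2 (W.reductionPointCount 2) + padicValNat 2 W.tamagawaProduct) := by
  haveI : Module.Finite (IwasawaAlgebra 2) D.X := D.module_finite_holds hγ
  haveI : Finite ↥(W.selmerLayer κ₂ 0) := W.finite_selmerLayer_zero κ₂ hSel
  obtain ⟨hfin, hle⟩ := natCard_kerG_zero_le_two_pow W κ₂ hgo hκ S hS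
  haveI := hfin
  have hdvd := pow_mu_dvd_natCard_selmerLayer_zero_mul_kerG_zero W κ₂ hγ D hD
  rw [W.natCard_selmerLayer_zero_eq κ₂] at hdvd
  refine ⟨hdvd, ?_⟩
  have h1 : 2 ^ D.mu ≤ Nat.card ↥(W.selmerGroupPInfty 2) * 2 ^ (2 * padicValNat 2 (W.reductionPointCount 2) + padicValNat 2 W.tamagawaProduct) :=
    (Nat.le_of_dvd (Nat.mul_pos Nat.card_pos Nat.card_pos) hdvd).trans (Nat.mul_le_mul_left _ hle)
  have h2 := Nat.le_log_of_pow_le (by norm_num : 1 < 2) h1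
  rwa [log_mul_pow_eq _ _ Nat.card_pos.ne'] at h2

end Two

end Summit.BirchSwinnertonDyer.BirchSwinnertonDyer.Theorems.AlignedTransportAtTwoHalfDescentBaseIndexTamagawa

end
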